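import Summits.CriticalPhenomena.CardyFormulaZ2.Theorems.CardyBoundaryCoulombGasRectilinearSufficesSandwich
import Literature.Probability.LatticeModels.MeshDomainJordan
import Literature.Probability.RandomPlanarGeometry.PlanarDomainsTopology

/-!
# Crossing events of conformal rectangles in mixed position: the geometric wrapper

Support file for `RectilinearSuffices` (route CardyBoundaryCoulombGas of `CardyFormulaZ2`,
item stmt-CriticalPhenomena-5663). From the combinatorial sandwich
`discreteCrossing_subset_of_mixed` and the bulk theorem for the largest-component discretisation
of a Jordan domain (`JordanDomain.exists_forall_mem_meshDomain_and_reachable`) we derive: if two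
conformal rectangles `R'` (lower) and `R''` (upper) are in **mixed position** — `closure R' ⊆
R'' ∪ F₀ ∪ F₂` with compact `F₀, F₂` off `R''`, `F₀` off a closed set containing `∂R'' ∖ arc₀''`,
`F₂` off one containing `∂R'' ∖ arc₂''`, and the arcs `arc₀', arc₂'` of `R'` off `closure R''` and
off `F₂, F₀` respectively — then for all small meshes the G02 crossing event of `R'` is contained
in that of `R''` (`exists_forall_discreteCrossing_subset_of_mixed`). All metric thresholds are
produced here from disjointness of compact and closed sets.
-/

noncomputable section

namespace Summit.CriticalPhenomena.CardyFormulaZ2.Theorems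

open Set Metric
open Literature.Probability.LatticeModels Literature.Probability.Percolation
open Literature.Probability.RandomPlanarGeometry

/-- A compact set and a disjoint closed set are a positive distance apart (vacuous form allowing
an empty closed set). [folklore] -/
theorem exists_pos_forall_lt_dist {S T : Set ℂ} (hS : IsCompact S) (hT : IsClosed T)
    (hST : Disjoint S T) : ∃ r > 0, ∀ p ∈ S, ∀ q ∈ T, r < dist p q := by
  rcases T.eq_empty_or_nonempty with rfl | hTne
  · exact ⟨1, one_pos, fun p _ q hq => hq.elim⟩
  obtain ⟨r, hr, h⟩ := exists_pos_forall_lt_infDist hS hT hST hTne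
  exact ⟨r, hr, fun p hp q hq => (h p hp).trans_le (infDist_le_dist_of_mem hq)⟩

/-- **Discrete arcs hug the continuum arc.** For an open set `Ω` with the bulk property at scale
`ε` (lattice points of `Ω` at distance `≥ ε` from `∂Ω` lie in `Ω_δ`), every vertex of the discrete
arc `discreteArc Ω δ A` of a nonempty `A ⊆ ∂Ω` has its mesh point within `ε + 2δ` of `A`: a
boundary vertex of `Ω_δ` is within `ε + δ` of `∂Ω` (its defect neighbour is outside `Ω`, or the
mesh edge leaves `closure Ω`, or the neighbour is a stray vertex, hence `ε`-close to `∂Ω`), and a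
vertex of the discrete arc is at least as close to `A` as to the rest of `∂Ω`. [folklore] -/
theorem infDist_lt_of_mem_discreteArc {Ω A : Set ℂ} (hΩ : IsOpen Ω) (hA : A ⊆ frontier Ω)
    (hAne : A.Nonempty) {δ ε : ℝ} (hδ : 0 < δ) (hε : 0 < ε)
    (hbulk' : ∀ z : Site 2, meshPoint δ z ∈ Ω → ε ≤ infDist (meshPoint δ z) (frontier Ω) →
      z ∈ meshDomain Ω δ)
    {x : Site 2} (hx : x ∈ discreteArc Ω δ A) : infDist (meshPoint δ x) A < ε + 2 * δ := by
  obtain ⟨⟨hxM, y, hxy, hnadj⟩, harc⟩ := hx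
  have hxΩ : meshPoint δ x ∈ Ω := meshDomain_subset_meshVertices _ _ hxM
  have hdxy : dist (meshPoint δ x) (meshPoint δ y) = δ := by
    rw [dist_meshPoint_of_adj hxy, abs_of_pos hδ]
  have hfrne : (frontier Ω).Nonempty := hAne.mono hA
  -- a boundary vertex is within `ε + δ` of the frontier
  have hfr : infDist (meshPoint δ x) (frontier Ω) ≤ ε + δ := by
    -- if the mesh edge to `y` leaves `Ω`, it meets the frontier within `δ`
    by_cases hseg : segment ℝ (meshPoint δ x) (meshPoint δ y) ⊆ Ω
    · -- then `y` is a mesh neighbour inside `Ω`; it is not in `Ω_δ`, hence stray, hence `ε`-close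
      have hyΩ : meshPoint δ y ∈ Ω := hseg (right_mem_segment _ _ _)
      have hmesh : (meshGraph Ω δ).Adj x y :=
        meshGraph_adj_iff.2 ⟨hxy, hseg.trans subset_closure⟩
      have hyM : y ∉ meshDomain Ω δ := fun hyM =>
        hnadj (discreteDomainGraph_adj_iff.2 ⟨hmesh, hxM, hyM⟩)
      have hylt : infDist (meshPoint δ y) (frontier Ω) < ε := by
        by_contra h
        exact hyM (hbulk' y hyΩ (not_lt.1 h))
      have := infDist_le_infDist_add_dist (x := meshPoint δ x) (y := meshPoint δ y)
        (s := frontier Ω)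
      linarith
    · obtain ⟨w, hw, hwf⟩ := exists_mem_segment_frontier hΩ hxΩ hseg
      have hxw : dist (meshPoint δ x) w ≤ δ := (dist_le_of_mem_segment_left hw).trans hdxy.le
      exact ((infDist_le_dist_of_mem hwf).trans hxw).trans (by linarith)
  -- a frontier point within `ε + 2δ`; it lies on `A` or on the rest, and `x` prefers `A`
  have hlt : infDist (meshPoint δ x) (frontier Ω) < ε + 2 * δ := by linarith
  obtain ⟨w, hwf, hw⟩ := (infDist_lt_iff hfrne).1 hlt
  by_cases hwA : w ∈ A
  · exact (infDist_le_dist_of_mem hwA).trans_lt hw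
  · exact (harc.trans (infDist_le_dist_of_mem ⟨hwf, hwA⟩)).trans_lt hw

/-- **Crossing events of conformal rectangles in mixed position are nested, for all small meshes.**
See the module docstring for the hypotheses; the conclusion feeds the monotonicity of
probabilities `bondDomainCrossingProb R' δ ≤ bondDomainCrossingProb R'' δ` for `δ` small. [folklore] -/
theorem exists_forall_discreteCrossing_subset_of_mixed (R' R'' : ConformalRectangle)
    {F0 F2 C0 C2 : Set ℂ} (hF0 : IsCompact F0) (hF2 : IsCompact F2)
    (hC0 : IsClosed C0) (hC2 : IsClosed C2)
    (hcl : closure R'.carrier ⊆ R''.carrier ∪ F0 ∪ F2)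
    (hF0Ω : Disjoint F0 R''.carrier) (hF2Ω : Disjoint F2 R''.carrier) (hF02 : Disjoint F0 F2)
    (hfr0 : frontier R''.carrier \ R''.arc 0 ⊆ C0) (hfr2 : frontier R''.carrier \ R''.arc 2 ⊆ C2)
    (hF0C : Disjoint F0 C0) (hF2C : Disjoint F2 C2)
    (hne0 : (frontier R''.carrier \ R''.arc 0).Nonempty)
    (hne2 : (frontier R''.carrier \ R''.arc 2).Nonempty)
    (hA0 : Disjoint (R'.arc 0) (closure R''.carrier)) (hA2 : Disjoint (R'.arc 2) (closure R''.carrier))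
    (hA0F : Disjoint (R'.arc 0) F2) (hA2F : Disjoint (R'.arc 2) F0) :
    ∃ δ₀ > 0, ∀ δ, 0 < δ → δ < δ₀ →
      discreteCrossing R'.carrier δ (R'.arc 0) (R'.arc 2) ⊆
        discreteCrossing R''.carrier δ (R''.arc 0) (R''.arc 2) := by
  -- the positive separations
  obtain ⟨d1, hd1, h1⟩ := exists_pos_forall_lt_dist hF0 hF2.isClosed hF02
  obtain ⟨d2, hd2, h2⟩ := exists_pos_forall_lt_dist hF0 hC0 hF0C
  obtain ⟨d3, hd3, h3⟩ := exists_pos_forall_lt_dist hF2 hC2 hF2C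
  obtain ⟨d4, hd4, h4⟩ := exists_pos_forall_lt_dist (R'.isCompact_arc 0) isClosed_closure hA0
  obtain ⟨d5, hd5, h5⟩ := exists_pos_forall_lt_dist (R'.isCompact_arc 2) isClosed_closure hA2
  obtain ⟨d6, hd6, h6⟩ := exists_pos_forall_lt_dist (R'.isCompact_arc 0) hF2.isClosed hA0F
  obtain ⟨d7, hd7, h7⟩ := exists_pos_forall_lt_dist (R'.isCompact_arc 2) hF0.isClosed hA2F
  -- a common scale `ε`
  obtain ⟨ε, hε, hε1, hε2, hε3, hε4, hε5, hε6, hε7⟩ : ∃ ε > 0, 8 * ε ≤ d1 ∧ 8 * ε ≤ d2 ∧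
      8 * ε ≤ d3 ∧ 8 * ε ≤ d4 ∧ 8 * ε ≤ d5 ∧ 8 * ε ≤ d6 ∧ 8 * ε ≤ d7 := by
    refine ⟨min (min (min d1 d2) (min d3 d4)) (min (min d5 d6) d7) / 8, by positivity,
      ?_, ?_, ?_, ?_, ?_, ?_, ?_⟩ <;>
    · simp only [min_le_iff, le_refl, true_or, or_true,
        mul_div_cancel₀ _ (by norm_num : (8 : ℝ) ≠ 0)]
  -- bulk theorem for `R''` on `K = closure R' ∩ {ε ≤ infDist · F0} ∩ {ε ≤ infDist · F2}`
  set K : Set ℂ := closure R'.carrier ∩ {z | ε ≤ infDist z F0} ∩ {z | ε ≤ infDist z F2} with hK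
  have hKc : IsCompact K :=
    ((R'.isBounded.isCompact_closure.inter_right
      (isClosed_le continuous_const (continuous_infDist_pt F0))).inter_right
      (isClosed_le continuous_const (continuous_infDist_pt F2)))
  have hKsub : K ⊆ R''.carrier := by
    rintro z ⟨⟨hz, hz0⟩, hz2⟩
    rcases hcl hz with (h | h) | h
    · exact h
    · exact absurd (hz0.trans_eq (infDist_zero_of_mem h)) (not_le.2 hε)
    · exact absurd (hz2.trans_eq (infDist_zero_of_mem h)) (not_le.2 hε)
  obtain ⟨δ₁, hδ₁, hbulk1⟩ := R''.toJordanDomain.exists_forall_mem_meshDomain_and_reachable hKc hKsub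
  -- bulk theorem for `R'` on `K' = closure R' ∩ {ε ≤ infDist · (frontier R')}`
  set K' : Set ℂ := closure R'.carrier ∩ {z | ε ≤ infDist z (frontier R'.carrier)} with hK'
  have hK'c : IsCompact K' :=
    R'.isBounded.isCompact_closure.inter_right
      (isClosed_le continuous_const (continuous_infDist_pt _))
  have hK'sub : K' ⊆ R'.carrier := by
    rintro z ⟨hz, hzf⟩
    rw [closure_eq_self_union_frontier] at hz
    rcases hz with h | h
    · exact h
    · exact absurd (hzf.trans_eq (infDist_zero_of_mem h)) (not_le.2 hε)
  obtain ⟨δ₂, hδ₂, hbulk2⟩ := R'.toJordanDomain.exists_forall_mem_meshDomain_and_reachable hK'c hK'sub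
  -- the threshold
  refine ⟨min (min δ₁ δ₂) ε, by positivity, fun δ hδ hδlt => ?_⟩
  have hδ1 : δ < δ₁ := hδlt.trans_le ((min_le_left _ _).trans (min_le_left _ _))
  have hδ2 : δ < δ₂ := hδlt.trans_le ((min_le_left _ _).trans (min_le_right _ _))
  have hδε : δ < ε := hδlt.trans_le (min_le_right _ _)
  have hbulk'' : ∀ z : Site 2, meshPoint δ z ∈ closure R'.carrier → meshPoint δ z ∈ R''.carrier →
      ε ≤ infDist (meshPoint δ z) F0 → ε ≤ infDist (meshPoint δ z) F2 →
      z ∈ meshDomain R''.carrier δ :=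
    fun z hz _ h0 h2 => (hbulk1 δ hδ hδ1).1 z ⟨⟨hz, h0⟩, h2⟩
  have hbulk' : ∀ z : Site 2, meshPoint δ z ∈ R'.carrier →
      ε ≤ infDist (meshPoint δ z) (frontier R'.carrier) → z ∈ meshDomain R'.carrier δ :=
    fun z hz hf => (hbulk2 δ hδ hδ2).1 z ⟨subset_closure hz, hf⟩
  -- the discrete arcs of `R'` lie in `F0`, `F2`
  have hends : ∀ (i : Fin 4) (F E : Set ℂ), (i = 0 ∨ i = 2) →
      (∀ p ∈ R'.arc i, ∀ q ∈ closure R''.carrier, 8 * ε < dist p q) →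
      (∀ p ∈ R'.arc i, ∀ q ∈ E, 8 * ε < dist p q) →
      closure R'.carrier ⊆ R''.carrier ∪ F ∪ E ∨ closure R'.carrier ⊆ R''.carrier ∪ E ∪ F →
      ∀ x ∈ discreteArc R'.carrier δ (R'.arc i), meshPoint δ x ∈ F := by
    intro i F E _ hcl' hE hcl'' x hx
    have hlt := infDist_lt_of_mem_discreteArc R'.isOpen (R'.arc_subset_frontier i)
      ⟨_, R'.pt_mem_arc_self i⟩ hδ hε hbulk' hx
    obtain ⟨a0, ha0, hxa0⟩ := (infDist_lt_iff ⟨_, R'.pt_mem_arc_self i⟩).1 hlt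
    rw [dist_comm] at hxa0
    have hx3 : dist a0 (meshPoint δ x) < 8 * ε := by linarith
    have hxcl : meshPoint δ x ∈ closure R'.carrier :=
      subset_closure (meshDomain_subset_meshVertices _ _ hx.1.1)
    have hnot1 : meshPoint δ x ∉ R''.carrier := fun h =>
      lt_asymm hx3 (hcl' a0 ha0 _ (subset_closure h))
    have hnot2 : meshPoint δ x ∉ E := fun h => lt_asymm hx3 (hE a0 ha0 _ h)
    rcases hcl'' with hc | hc
    · rcases hc hxcl with (h | h) | h
      · exact absurd h hnot1
      · exact h
      · exact absurd h hnot2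
    · rcases hc hxcl with (h | h) | h
      · exact absurd h hnot1
      · exact absurd h hnot2
      · exact h
  have hstart : ∀ x ∈ discreteArc R'.carrier δ (R'.arc 0), meshPoint δ x ∈ F0 :=
    hends 0 F0 F2 (Or.inl rfl) (fun p hp q hq => lt_of_le_of_lt hε4 (h4 p hp q hq))
      (fun p hp q hq => lt_of_le_of_lt hε6 (h6 p hp q hq)) (Or.inl hcl)
  have hend : ∀ x ∈ discreteArc R'.carrier δ (R'.arc 2), meshPoint δ x ∈ F2 :=
    hends 2 F2 F0 (Or.inr rfl) (fun p hp q hq => lt_of_le_of_lt hε5 (h5 p hp q hq))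
      (fun p hp q hq => lt_of_le_of_lt hε7 (h7 p hp q hq)) (Or.inr hcl)
  -- conclude by the combinatorial sandwich
  refine discreteCrossing_subset_of_mixed hδ hδε.le R''.isOpen hF0.isClosed hcl hF0Ω hF2Ω
    (fun p hp q hq => ?_) (fun p hp q hq => ?_) (fun p hp q hq => ?_) hne0 hne2 hbulk'' hstart hend
  · have := h1 p hp q hq; linarith
  · have := h2 p hp q (hfr0 hq); linarith
  · have := h3 p hp q (hfr2 hq); linarith

end Summit.CriticalPhenomena.CardyFormulaZ2.Theorems
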